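import Summits.NavierStokesRegularity.NavierStokesRegularity.Theorems.LerayQuarterDissipationFiniteDissipationLiouvilleVorticityAlignment
import HarnessLib

/-!
# Crux `FiniteDissipationLiouville` (stmt-NavierStokesRegularity-22144): the GIGA–MIURA
# CONTINUOUS-ALIGNMENT REGIME IS EXCLUDED for the residue; periodic slices; the crux restricted
# to direction-oscillating profiles

Theorems file of route `LerayQuarterDissipation` (lead prover ns-lqd-lead g8; `--supports` the
crux, line `birth`; portrait facts for the registered stub `stub_envelopeCriticalLiouville`).
Navier–Stokes regularity is NOT proved by anything here; no summit is.

`𝒟_{C,K}`: Type-I ancient mild fields (KNSS gauge) with the law `∫ ‖∇w(s)‖² ≤ K/√(−s)`;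
`ξ = vorticityDirection (curl (w t))`.

* `not_continuousAlignment_of_singular` — **the hypothesis (D) of Giga–Miura 2011, Thm 2.10, in
  its SIGN-BLIND form (`min(‖ξ(x)−ξ(y)‖, ‖ξ(x)+ξ(y)‖) ≤ η(‖x−y‖)` on `{|ω| > d} ∩ B(r₀)`,
  `t ∈ (−r₀², 0)`), for ANY level `d ≥ 0` and ANY modulus `η → 0⁺`, fails for every singular member
  of `𝒟_{C,K}`** (from the direction-oscillation floor `directionOscillation_floor_of_singular`:
  at a late instant the two `δ`-incoherent points lie in `B(r₀)`, carry vorticity `> δ/(−t) > d`,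
  and are `2δ⁻¹√(−t)`-close, where `η < δ`). The Giga–Miura regime joins the excluded regimes of
  the crux (small constants, axisymmetric, DSS with factor near one, one calm / quiet slice, quiet
  vorticity core);
* `slice_eq_zero_of_periodic`, `not_singular_of_periodic_slice` — a member with ONE slice periodic
  in some direction vanishes at that instant, hence is regular (no symmetry; cf. Lei–Ren–Zhang for
  bounded ancient axisymmetric `z`-periodic fields);
* `finiteDissipationLiouville_iff_directionOscillating` — the crux is equivalent to its restriction
  to profiles carrying the direction-oscillation floor at every instant.

HONEST FRAMING. Portrait facts; no DSS scenario with genuinely three-dimensional vorticity is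
removed. The printed Theorem 2.10 (suitable weak solutions, local Type I) is NOT discharged here —
the class differs (mild ancient fields with the dissipation law); what is proved is its analogue,
with a weaker (sign-blind, merely `η → 0`) hypothesis, inside `𝒟_{C,K}`.

References: Giga–Miura 2011 (CMP 303 = HUPS #956), Thm 2.10; Koch–Nadirashvili–Seregin–Šverák
2009, §4; Lei–Ren–Zhang 2022 (Math. Ann.).
-/

noncomputable section

-- the summit and its single sub-problem share the name (CONVENTIONS §1), as in every Theorems file
set_option linter.dupNamespace false

namespace Summit.NavierStokesRegularity.NavierStokesRegularity.Theorems.FiniteDissipationLiouville.VorticityAlignment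

open MeasureTheory Set Filter Topology Metric Function
open Literature.Analysis Literature.Analysis.FluidPDE
open Summit.NavierStokesRegularity.NavierStokesRegularity.Theorems.FiniteDissipationLiouville
open scoped ENNReal NNReal Laplacian RealInnerProductSpace

/-! ### The Giga–Miura continuous-alignment regime is excluded for the residue -/

/-- **NO CONTINUOUS ALIGNMENT NEAR A FINITE-DISSIPATION TYPE-I SINGULARITY (Giga–Miura regime,
sign-blind).** A SINGULAR member of `𝒟_{C,K}` admits no level `d ≥ 0`, radius `r₀ > 0` and modulus
`η` with `η(s) → 0` as `s → 0⁺` such that on `(−r₀², 0) × B(0, r₀)` the vorticity directions at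
points of vorticity `> d` satisfy `min(‖ξ(x,t) − ξ(y,t)‖, ‖ξ(x,t) + ξ(y,t)‖) ≤ η(‖x − y‖)`. In
particular the hypothesis (D) of Giga–Miura 2011, Thm 2.10 (`‖ξ(x,t) − ξ(y,t)‖ ≤ η(‖x − y‖)` on
`Ω_d(t) = {x ∈ B(r₀) : |ω(x,t)| > d}`) fails for every singular member: by the floor, at every late
instant two points of `B(0, δ⁻¹√(−t)) ⊂ B(r₀)` with vorticity `> δ/(−t) > d` have directions
`δ`-apart modulo sign, while `η(‖x − y‖) ≤ η(2δ⁻¹√(−t)) → 0`. [cite: GigaMiura2011, Thm 2.10 (HUPS preprint #956 p. 10)] -/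
theorem not_continuousAlignment_of_singular {C K : ℝ}
    {w : ℝ → EuclideanSpace ℝ (Fin 3) → EuclideanSpace ℝ (Fin 3)}
    (hw : IsTypeIAncientMild C w)
    (hlaw : ∀ s : ℝ, s < 0 → ∫⁻ x, ‖fderiv ℝ (w s) x‖ₑ ^ 2 ≤ ENNReal.ofReal (K / Real.sqrt (-s)))
    (hsing : ∀ ρ > 0, ∀ M : ℝ, ∃ t ∈ Ioo (-(ρ ^ 2)) (0 : ℝ),
      ∃ x ∈ ball (0 : EuclideanSpace ℝ (Fin 3)) ρ, M < ‖w t x‖) :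
    ¬ (∃ d : ℝ, 0 ≤ d ∧ ∃ r₀ : ℝ, 0 < r₀ ∧ ∃ η : ℝ → ℝ, Tendsto η (𝓝[>] 0) (𝓝 0) ∧
        ∀ t ∈ Ioo (-(r₀ ^ 2)) (0 : ℝ), ∀ x ∈ ball (0 : EuclideanSpace ℝ (Fin 3)) r₀,
          ∀ y ∈ ball (0 : EuclideanSpace ℝ (Fin 3)) r₀,
            d < ‖curl (w t) x‖ → d < ‖curl (w t) y‖ →
            min ‖vorticityDirection (curl (w t)) x - vorticityDirection (curl (w t)) y‖
                ‖vorticityDirection (curl (w t)) x + vorticityDirection (curl (w t)) y‖ ≤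
              η ‖x - y‖) := by
  rintro ⟨d, hd, r₀, hr₀, η, hη, hD⟩
  obtain ⟨δ, hδ, hfloor⟩ := directionOscillation_floor_of_singular C K
  have hfl := hfloor w hw hlaw hsing
  -- `η < δ` on some `(0, s₀)`
  have hηev : ∀ᶠ s in 𝓝[>] (0 : ℝ), η s < δ := hη.eventually (gt_mem_nhds hδ)
  obtain ⟨s₀, hs₀, hηs⟩ : ∃ s₀ > 0, ∀ s, 0 < s → s < s₀ → η s < δ := by
    rcases (nhdsGT_basis (0 : ℝ)).eventually_iff.1 hηev with ⟨s₀, hs₀, hsub⟩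
    exact ⟨s₀, hs₀, fun s h1 h2 => hsub ⟨h1, h2⟩⟩
  -- a late instant `t = -τ`
  have hsq : Tendsto (fun τ : ℝ => Real.sqrt τ) (𝓝[>] 0) (𝓝 0) := by
    have h := Real.continuous_sqrt.tendsto (0 : ℝ)
    rw [Real.sqrt_zero] at h
    exact h.mono_left nhdsWithin_le_nhds
  have hev1 : ∀ᶠ τ in 𝓝[>] (0 : ℝ), τ < r₀ ^ 2 :=
    mem_nhdsWithin_of_mem_nhds (gt_mem_nhds (by positivity))
  have hev2 : ∀ᶠ τ in 𝓝[>] (0 : ℝ), δ⁻¹ * Real.sqrt τ < r₀ := by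
    have : Tendsto (fun τ : ℝ => δ⁻¹ * Real.sqrt τ) (𝓝[>] 0) (𝓝 0) := by
      simpa using hsq.const_mul δ⁻¹
    exact this.eventually (gt_mem_nhds hr₀)
  have hev3 : ∀ᶠ τ in 𝓝[>] (0 : ℝ), τ * (d + 1) < δ := by
    have : Tendsto (fun τ : ℝ => τ * (d + 1)) (𝓝[>] 0) (𝓝 0) := by
      have h0 : Tendsto (fun τ : ℝ => τ * (d + 1)) (𝓝 0) (𝓝 (0 * (d + 1))) :=
        tendsto_id.mul_const (d + 1)
      rw [zero_mul] at h0
      exact h0.mono_left nhdsWithin_le_nhds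
    exact this.eventually (gt_mem_nhds hδ)
  have hev4 : ∀ᶠ τ in 𝓝[>] (0 : ℝ), 2 * (δ⁻¹ * Real.sqrt τ) < s₀ := by
    have : Tendsto (fun τ : ℝ => 2 * (δ⁻¹ * Real.sqrt τ)) (𝓝[>] 0) (𝓝 0) := by
      simpa using (hsq.const_mul δ⁻¹).const_mul 2
    exact this.eventually (gt_mem_nhds hs₀)
  have hev0 : ∀ᶠ τ in 𝓝[>] (0 : ℝ), 0 < τ := eventually_mem_nhdsWithin
  obtain ⟨τ, hτ0, hτ1, hτ2, hτ3, hτ4⟩ := (hev0.and (hev1.and (hev2.and (hev3.and hev4)))).exists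
  have ht : -τ < 0 := neg_neg_of_pos hτ0
  obtain ⟨x, hx, y, hy, hlx, hly, hdiff, hsum⟩ := hfl (-τ) ht
  rw [neg_neg] at hx hy hlx hly
  -- the points lie in `B(0, r₀)` and the instant in `(−r₀², 0)`
  have hxr : x ∈ ball (0 : EuclideanSpace ℝ (Fin 3)) r₀ := ball_subset_ball hτ2.le hx
  have hyr : y ∈ ball (0 : EuclideanSpace ℝ (Fin 3)) r₀ := ball_subset_ball hτ2.le hy
  have htI : -τ ∈ Ioo (-(r₀ ^ 2)) (0 : ℝ) := ⟨by linarith, ht⟩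
  -- the levels: `d < ‖ω‖` from `δ < τ‖ω‖` and `τ (d+1) < δ`
  have hlev : ∀ z, δ < τ * ‖curl (w (-τ)) z‖ → d < ‖curl (w (-τ)) z‖ := by
    intro z hz
    by_contra hle
    push Not at hle
    have : τ * ‖curl (w (-τ)) z‖ ≤ τ * (d + 1) :=
      mul_le_mul_of_nonneg_left (by linarith) hτ0.le
    linarith
  have key := hD (-τ) htI x hxr y hyr (hlev x hlx) (hlev y hly)
  -- `0 < ‖x − y‖ < s₀`, so `η ‖x − y‖ < δ`
  have hxy0 : 0 < ‖x - y‖ := by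
    rw [norm_pos_iff, sub_ne_zero]
    rintro rfl
    rw [sub_self, norm_zero] at hdiff
    exact lt_irrefl _ (hdiff.trans hδ)
  have hxy1 : ‖x - y‖ < s₀ := by
    have hx' := mem_ball_zero_iff.1 hx
    have hy' := mem_ball_zero_iff.1 hy
    calc ‖x - y‖ ≤ ‖x‖ + ‖y‖ := norm_sub_le x y
      _ < 2 * (δ⁻¹ * Real.sqrt τ) := by linarith
      _ < s₀ := hτ4
  have hηlt := hηs ‖x - y‖ hxy0 hxy1
  have hmin : δ < min ‖vorticityDirection (curl (w (-τ))) x - vorticityDirection (curl (w (-τ))) y‖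
      ‖vorticityDirection (curl (w (-τ))) x + vorticityDirection (curl (w (-τ))) y‖ :=
    lt_min hdiff hsum
  linarith

/-! ### Periodic slices, and the crux restricted to direction-oscillating profiles -/

/-- **A member of `𝒟_{C,K}` with ONE slice periodic in some direction vanishes at that instant**
(no symmetry assumed): a continuous `L⁶` slice invariant under a nonzero translation is zero
(`eq_zero_of_memLp_of_translate_invariant`). Compare Lei–Ren–Zhang (bounded ancient AXISYMMETRIC
fields periodic in `z` are constant): in the finite-dissipation class periodicity of a single
slice already forces triviality. [cite: KochNadirashviliSereginSverak2009, §4 (arXiv:0709.3599 p. 8)] -/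
theorem slice_eq_zero_of_periodic {C K : ℝ}
    {w : ℝ → EuclideanSpace ℝ (Fin 3) → EuclideanSpace ℝ (Fin 3)}
    (hw : IsTypeIAncientMild C w)
    (hlaw : ∀ s : ℝ, s < 0 → ∫⁻ x, ‖fderiv ℝ (w s) x‖ₑ ^ 2 ≤ ENNReal.ofReal (K / Real.sqrt (-s)))
    {s : ℝ} (hs : s < 0) {v : EuclideanSpace ℝ (Fin 3)} (hv : v ≠ 0)
    (hper : ∀ x, w s (x + v) = w s x) : ∀ x, w s x = 0 := by
  obtain ⟨CL, -, hL6⟩ := Birth.memLp_six_slice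
  exact eq_zero_of_memLp_of_translate_invariant (hw.contDiff_slice hs).continuous
    (hL6 C K w hw hlaw s hs).1 hv hper

/-- **A member of `𝒟_{C,K}` with ONE periodic slice is bounded at the apex** (the slice vanishes;
forward uniqueness from the zero slice). [cite: KochNadirashviliSereginSverak2009, §4 (arXiv:0709.3599 p. 8)] -/
theorem not_singular_of_periodic_slice {C K : ℝ}
    {w : ℝ → EuclideanSpace ℝ (Fin 3) → EuclideanSpace ℝ (Fin 3)}
    (hw : IsTypeIAncientMild C w)
    (hlaw : ∀ s : ℝ, s < 0 → ∫⁻ x, ‖fderiv ℝ (w s) x‖ₑ ^ 2 ≤ ENNReal.ofReal (K / Real.sqrt (-s)))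
    {s : ℝ} (hs : s < 0) {v : EuclideanSpace ℝ (Fin 3)} (hv : v ≠ 0)
    (hper : ∀ x, w s (x + v) = w s x) :
    ¬ (∀ r > 0, ∀ M : ℝ, ∃ t ∈ Ioo (-(r ^ 2)) (0 : ℝ),
        ∃ x ∈ ball (0 : EuclideanSpace ℝ (Fin 3)) r, M < ‖w t x‖) :=
  CalmSlice.not_singular_of_zero_slice hw hs (slice_eq_zero_of_periodic hw hlaw hs hv hper)

/-- **The crux is equivalent to its restriction to DIRECTION-OSCILLATING profiles**: to prove
`FiniteDissipationLiouville` it suffices to exclude singular members of `𝒟_{C,K}` which carry, for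
some `δ > 0`, at EVERY instant two points of `B(0, δ⁻¹√(−t))` with scaled vorticity `> δ` and
directions `δ`-apart modulo sign (the others are regular by `directionCoherence_leaf`).
[cite: GigaMiura2011, Thm 2.10 (HUPS preprint #956 p. 10)] -/
theorem finiteDissipationLiouville_iff_directionOscillating :
    Summit.NavierStokesRegularity.NavierStokesRegularity.Theses.LerayQuarterDissipation.FiniteDissipationLiouville ↔
    ∀ (C K : ℝ) (ū : ℝ → EuclideanSpace ℝ (Fin 3) → EuclideanSpace ℝ (Fin 3)),
      IsTypeIAncientMild C ū →
      (∀ s : ℝ, s < 0 → ∫⁻ x, ‖fderiv ℝ (ū s) x‖ₑ ^ 2 ≤ ENNReal.ofReal (K / Real.sqrt (-s))) →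
      (∃ δ > 0, ∀ t < 0, ∃ x ∈ ball (0 : EuclideanSpace ℝ (Fin 3)) (δ⁻¹ * Real.sqrt (-t)),
        ∃ y ∈ ball (0 : EuclideanSpace ℝ (Fin 3)) (δ⁻¹ * Real.sqrt (-t)),
          δ < (-t) * ‖curl (ū t) x‖ ∧ δ < (-t) * ‖curl (ū t) y‖ ∧
          δ < ‖vorticityDirection (curl (ū t)) x - vorticityDirection (curl (ū t)) y‖ ∧
          δ < ‖vorticityDirection (curl (ū t)) x + vorticityDirection (curl (ū t)) y‖) →
      ¬ (∀ r > 0, ∀ M : ℝ, ∃ t ∈ Ioo (-(r ^ 2)) (0 : ℝ),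
        ∃ x ∈ ball (0 : EuclideanSpace ℝ (Fin 3)) r, M < ‖ū t x‖) := by
  unfold Summit.NavierStokesRegularity.NavierStokesRegularity.Theses.LerayQuarterDissipation.FiniteDissipationLiouville
  refine ⟨fun h C K ū hū hlaw _ => h C K ū hū hlaw, fun h C K ū hū hlaw hsing => ?_⟩
  by_cases hosc : ∃ δ > 0, ∀ t < 0, ∃ x ∈ ball (0 : EuclideanSpace ℝ (Fin 3)) (δ⁻¹ * Real.sqrt (-t)),
      ∃ y ∈ ball (0 : EuclideanSpace ℝ (Fin 3)) (δ⁻¹ * Real.sqrt (-t)),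
        δ < (-t) * ‖curl (ū t) x‖ ∧ δ < (-t) * ‖curl (ū t) y‖ ∧
        δ < ‖vorticityDirection (curl (ū t)) x - vorticityDirection (curl (ū t)) y‖ ∧
        δ < ‖vorticityDirection (curl (ū t)) x + vorticityDirection (curl (ū t)) y‖
  · exact h C K ū hū hlaw hosc hsing
  · obtain ⟨δ, hδ, hfloor⟩ := directionOscillation_floor_of_singular C K
    exact hosc ⟨δ, hδ, hfloor ū hū hlaw hsing⟩


/-! ### The printed hypothesis (D), verbatim shape -/

/-- **Giga–Miura 2011, Theorem 2.10, hypothesis (D) in its PRINTED shape fails for every singular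
member of `𝒟_{C,K}`**: there are no radius `r₀ ∈ (0,1)`, level `d > 0` and modulus `η`
(non-decreasing and continuous on `[0,∞)`, `η(0) = 0`, as in `Literature.Analysis.FluidPDE.
gigaMiura2011_local_continuousAlignment_typeI`) with `‖ξ(x,t) − ξ(y,t)‖ ≤ η(‖x − y‖)` for all
`t ∈ (−1, 0)` and all `x, y ∈ B(0, r₀)` of vorticity `> d` (sign-sensitive alignment implies the
sign-blind one; a GM modulus tends to `0` at `0⁺`; `(−r₀², 0) ⊆ (−1, 0)`). The printed theorem
itself (suitable weak solutions, local Type I) is not discharged — this is its conclusion for the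
finite-dissipation Type-I ancient class. [cite: GigaMiura2011, Thm 2.10 with Def. 2.9 (HUPS preprint #956 p. 10)] -/
theorem not_gigaMiuraAlignment_of_singular {C K : ℝ}
    {w : ℝ → EuclideanSpace ℝ (Fin 3) → EuclideanSpace ℝ (Fin 3)}
    (hw : IsTypeIAncientMild C w)
    (hlaw : ∀ s : ℝ, s < 0 → ∫⁻ x, ‖fderiv ℝ (w s) x‖ₑ ^ 2 ≤ ENNReal.ofReal (K / Real.sqrt (-s)))
    (hsing : ∀ ρ > 0, ∀ M : ℝ, ∃ t ∈ Ioo (-(ρ ^ 2)) (0 : ℝ),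
      ∃ x ∈ ball (0 : EuclideanSpace ℝ (Fin 3)) ρ, M < ‖w t x‖) :
    ¬ (∃ r₀ : ℝ, 0 < r₀ ∧ r₀ < 1 ∧ ∃ d : ℝ, 0 < d ∧ ∃ η : ℝ → ℝ,
        MonotoneOn η (Ici 0) ∧ ContinuousOn η (Ici 0) ∧ η 0 = 0 ∧
        ∀ t ∈ Ioo (-1 : ℝ) 0, ∀ x ∈ ball (0 : EuclideanSpace ℝ (Fin 3)) r₀,
          ∀ y ∈ ball (0 : EuclideanSpace ℝ (Fin 3)) r₀,
            d < ‖curl (w t) x‖ → d < ‖curl (w t) y‖ →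
            ‖vorticityDirection (curl (w t)) x - vorticityDirection (curl (w t)) y‖ ≤ η ‖x - y‖) := by
  rintro ⟨r₀, hr₀, hr₁, d, hd, η, -, hηc, hη0, hD⟩
  refine not_continuousAlignment_of_singular hw hlaw hsing ⟨d, hd.le, r₀, hr₀, η, ?_, ?_⟩
  · -- a GM modulus tends to `0` at `0⁺`
    have h := (hηc 0 (by simp : (0 : ℝ) ∈ Ici (0 : ℝ))).tendsto
    rw [hη0] at h
    exact h.mono_left (nhdsWithin_mono _ fun s hs => mem_Ici.2 (le_of_lt (mem_Ioi.1 hs)))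
  · intro t ht x hx y hy hdx hdy
    have ht' : t ∈ Ioo (-1 : ℝ) 0 := by
      refine ⟨lt_of_le_of_lt ?_ ht.1, ht.2⟩
      have : r₀ ^ 2 < 1 := by nlinarith
      linarith
    exact (min_le_left _ _).trans (hD t ht' x hx y hy hdx hdy)

end Summit.NavierStokesRegularity.NavierStokesRegularity.Theorems.FiniteDissipationLiouville.VorticityAlignment

end
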